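import Mathlib
import Summits.ValiantsHypothesis.ValiantsHypothesis.Theorems.MonotoneRestorationOrbitRestorationQPValueOrbitRestoration
import Summits.ValiantsHypothesis.ValiantsHypothesis.Theorems.MonotoneRestorationOrbitRestorationQPDepthThreeRungDefs
import HarnessLib

/-!
# Supported derivative towers are orbit-restorable (toward the ΣΛΣ sub-rung of A_∞)

Route MonotoneRestoration, crux `OrbitRestorationQP` (stmt-ValiantsHypothesis-18293), line `depth-three-rung`,
stub A_∞ `stub_sigmaPiSigmaValue`.  Namespace `Summit.ValiantsHypothesis.ValiantsHypothesis.Theorems.DerivativeTower`.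

THE MECHANISM BEYOND IDENTIFIABILITY (evidence `A-INF-STRATA.md` on the item, "Recommended next").  A homogeneous
`f` of degree `d` is recovered from its first partial derivatives by EULER's identity `d·f = Σ_x X_x ∂_x f`, and
so on down the orders.  If at every order the relevant derivative space is spanned by polynomials SUPPORTED on
`≤ k` indices (fixed by the pointwise stabiliser of `≤ k` row/column indices), the resulting straight-line
computation is a VALUE DERIVATION all of whose values have `≤ (n+1)^{k+2}` diagonal translates — and in orbit
currency symmetry is then free (`ValueOrbit.qpOrbit_of_valueDerivation`): `f` is `QPOrbitRestorable (k+6)`.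
No canonical choices are needed (the coefficients of the linear combinations live in the STEPS, not in the
VALUES), and the number of values is irrelevant.

* `qpOrbitRestorable_of_tower` — **a supported derivative tower `T 0 ∋ f, T 1, …, T d` (levels homogeneous of
  degree `d − m`, `k`-supported, `∂_x (T m) ⊆ span (T (m+1))`) makes the diagonally invariant `f`
  `QPOrbitRestorable (k + 6) n f`.**

For ΣΛΣ-easy `f = Σ_{i<r} a_i ℓ_i^d` every derivative space has dimension `≤ r`; that such small
`S_n × S_n`-stable spaces are spanned by supported vectors is representation theory of `S_n` (small-degree
modules have small depth) — the one input left to make the whole ΣΛΣ sub-rung of A_∞ a theorem.  Everything in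
this file is proved. [folklore]
-/

noncomputable section

open scoped Classical

-- `Summit.ValiantsHypothesis.ValiantsHypothesis.…` is the tree's single-conjunct layout (Sub = Summit).
set_option linter.dupNamespace false

namespace Summit.ValiantsHypothesis.ValiantsHypothesis.Theorems

namespace DerivativeTower

open MvPolynomial Finset Equiv OrbitRestorationQPDepthThreeRung

variable {n : ℕ}

/-! ### Orbit bounds for supported values -/

/-- A product `X_x · q` with `q` supported on `Y` is supported on `Y ∪ {x₁, x₂}`. [folklore] -/
theorem supported_X_mul {q : MvPolynomial (Fin n × Fin n) ℂ} {Y : Finset (Fin n)}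
    (hY : ∀ ρ : Perm (Fin n), (∀ i ∈ Y, ρ i = i) → ren ρ q = q) (x : Fin n × Fin n) :
    ∀ ρ : Perm (Fin n), (∀ i ∈ insert x.1 (insert x.2 Y), ρ i = i) →
      ren ρ (MvPolynomial.X x * q) = MvPolynomial.X x * q := by
  intro ρ hρ
  have h1 : ρ x.1 = x.1 := hρ _ (Finset.mem_insert_self _ _)
  have h2 : ρ x.2 = x.2 := hρ _ (Finset.mem_insert_of_mem (Finset.mem_insert_self _ _))
  have hx : ρ • x = x := Prod.ext h1 h2
  rw [map_mul, ren_X, hx, hY ρ fun i hi => hρ i (Finset.mem_insert_of_mem (Finset.mem_insert_of_mem hi))]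

/-- Orbit bound for `X_x · q` with `q` supported on `≤ k` indices. [folklore] -/
theorem ncard_orbit_X_mul_le {k : ℕ} {q : MvPolynomial (Fin n × Fin n) ℂ} {Y : Finset (Fin n)}
    (hYk : Y.card ≤ k) (hY : ∀ ρ : Perm (Fin n), (∀ i ∈ Y, ρ i = i) → ren ρ q = q) (x : Fin n × Fin n) :
    (Set.range fun σ : Perm (Fin n) => ren σ (MvPolynomial.X x * q)).ncard ≤ (n + 1) ^ (k + 2) := by
  refine (ValueOrbit.orbit_bounded_of_supported (supported_X_mul hY x)).trans ?_
  refine Nat.pow_le_pow_right (Nat.succ_pos n) ?_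
  refine (Finset.card_insert_le _ _).trans ?_
  have := Finset.card_insert_le x.2 Y
  omega

/-- Orbit bound for a value supported on `≤ k` indices. [folklore] -/
theorem ncard_orbit_le_of_supported {k : ℕ} {q : MvPolynomial (Fin n × Fin n) ℂ} {Y : Finset (Fin n)}
    (hYk : Y.card ≤ k) (hY : ∀ ρ : Perm (Fin n), (∀ i ∈ Y, ρ i = i) → ren ρ q = q) :
    (Set.range fun σ : Perm (Fin n) => ren σ q).ncard ≤ (n + 1) ^ (k + 2) :=
  (ValueOrbit.orbit_bounded_of_supported hY).trans
    (Nat.pow_le_pow_right (Nat.succ_pos n) (hYk.trans (Nat.le_add_right k 2)))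

/-- Orbit bound for a variable. [folklore] -/
theorem ncard_orbit_X_le (k : ℕ) (x : Fin n × Fin n) :
    (Set.range fun σ : Perm (Fin n) => ren σ (MvPolynomial.X x : MvPolynomial (Fin n × Fin n) ℂ)).ncard ≤
      (n + 1) ^ (k + 2) := by
  have h := ncard_orbit_X_mul_le (k := k) (q := (1 : MvPolynomial (Fin n × Fin n) ℂ)) (Y := ∅)
    (by simp) (fun ρ _ => map_one _) x
  simpa only [mul_one] using h

/-- Arithmetic: `(n+1)^(k+2) ≤ 2^((log₂ n + (k+3))^(k+3))`. [folklore] -/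
theorem pow_le_qp (n k : ℕ) : (n + 1) ^ (k + 2) ≤ 2 ^ ((Nat.log 2 n + (k + 3)) ^ (k + 3)) := by
  have hL : n < 2 ^ (Nat.log 2 n + 1) := Nat.lt_pow_succ_log_self Nat.one_lt_two n
  generalize Nat.log 2 n = L at hL ⊢
  calc (n + 1) ^ (k + 2) ≤ (2 ^ (L + 1)) ^ (k + 2) := Nat.pow_le_pow_left (by omega) _
    _ = 2 ^ ((L + 1) * (k + 2)) := by rw [← pow_mul]
    _ ≤ 2 ^ ((L + (k + 3)) ^ (k + 3)) := Nat.pow_le_pow_right (by norm_num) (by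
        have h1 : (L + 1) * (k + 2) ≤ (L + (k + 3)) * (L + (k + 3)) := Nat.mul_le_mul (by omega) (by omega)
        have h2 : (L + (k + 3)) ^ 2 ≤ (L + (k + 3)) ^ (k + 3) := Nat.pow_le_pow_right (by omega) (by omega)
        rw [sq] at h2
        exact h1.trans h2)

/-! ### The tower theorem -/

/-- **SUPPORTED DERIVATIVE TOWERS ARE ORBIT-RESTORABLE.**  Let `T 0, T 1, …` be finite sets of polynomials on
the `n × n` matrix such that every `t ∈ T m` is homogeneous of degree `d − m`, is fixed by all permutations
fixing pointwise some set of `≤ k` indices, and has all its first partial derivatives in `span (T (m+1))`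
(for `m < d`).  Then every diagonally `Sym(Fin n)`-invariant `f ∈ T 0` is `QPOrbitRestorable (k + 6) n f`.
Mechanism: Euler's identity turns the tower into a value derivation whose values (`t`, `X_x · t'`, `X_x`)
have `≤ (n+1)^{k+2}` translates; `ValueOrbit.qpOrbit_of_valueDerivation`. [folklore] -/
theorem qpOrbitRestorable_of_tower {k d : ℕ} (T : ℕ → Finset (MvPolynomial (Fin n × Fin n) ℂ))
    (hhom : ∀ m, ∀ t ∈ T m, t.IsHomogeneous (d - m))
    (hsupp : ∀ m, ∀ t ∈ T m, ∃ Y : Finset (Fin n), Y.card ≤ k ∧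
      ∀ ρ : Perm (Fin n), (∀ i ∈ Y, ρ i = i) → ren ρ t = t)
    (hder : ∀ m, m < d → ∀ t ∈ T m, ∀ x : Fin n × Fin n,
      pderiv x t ∈ Submodule.span ℂ (T (m + 1) : Set (MvPolynomial (Fin n × Fin n) ℂ)))
    {f : MvPolynomial (Fin n × Fin n) ℂ} (hf : f ∈ T 0) (hfix : ∀ σ : Perm (Fin n), ren σ f = f) :
    QPOrbitRestorable (k + 6) n f := by
  -- the values
  set Vars : Finset (MvPolynomial (Fin n × Fin n) ℂ) :=
    (Finset.univ : Finset (Fin n × Fin n)).image fun x => MvPolynomial.X x with hVars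
  set Tall : Finset (MvPolynomial (Fin n × Fin n) ℂ) := (Finset.range (d + 1)).biUnion T with hTall
  set Mall : Finset (MvPolynomial (Fin n × Fin n) ℂ) := (Finset.range d).biUnion fun m =>
    ((Finset.univ : Finset (Fin n × Fin n)) ×ˢ T (m + 1)).image fun p => MvPolynomial.X p.1 * p.2 with hMall
  set S : Finset (MvPolynomial (Fin n × Fin n) ℂ) := Vars ∪ Tall ∪ Mall with hS
  -- the rank
  let rank : MvPolynomial (Fin n × Fin n) ℂ → ℕ := fun q =>
    if q.totalDegree = 0 then 0 else if q ∈ Vars then 0 else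
      if q ∈ Mall then 2 * q.totalDegree - 1 else 2 * q.totalDegree
  have hrank_le : ∀ q, rank q ≤ 2 * q.totalDegree := by
    intro q
    simp only [rank]
    split_ifs <;> omega
  -- degrees in the tower
  have hdegT : ∀ m, ∀ t ∈ T m, t ≠ 0 → t.totalDegree = d - m := fun m t ht h0 => (hhom m t ht).totalDegree h0
  have hdegM : ∀ m, ∀ t ∈ T (m + 1), ∀ x : Fin n × Fin n, MvPolynomial.X x * t ≠ 0 →
      (MvPolynomial.X x * t).totalDegree = d - (m + 1) + 1 := by
    intro m t ht x h0
    have ht0 : t ≠ 0 := fun h => h0 (by rw [h, mul_zero])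
    rw [totalDegree_mul_of_isDomain (X_ne_zero x) ht0, totalDegree_X, hdegT _ t ht ht0, add_comm]
  -- membership helpers
  have hXS : ∀ x, MvPolynomial.X x ∈ S := fun x =>
    Finset.mem_union_left _ (Finset.mem_union_left _ (Finset.mem_image.2 ⟨x, Finset.mem_univ _, rfl⟩))
  have hTS : ∀ m, m ≤ d → ∀ t ∈ T m, t ∈ S := fun m hm t ht =>
    Finset.mem_union_left _ (Finset.mem_union_right _
      (Finset.mem_biUnion.2 ⟨m, Finset.mem_range.2 (Nat.lt_succ_of_le hm), ht⟩))
  have hMmem : ∀ m, m < d → ∀ t ∈ T (m + 1), ∀ x : Fin n × Fin n, MvPolynomial.X x * t ∈ Mall :=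
    fun m hm t ht x => Finset.mem_biUnion.2 ⟨m, Finset.mem_range.2 hm,
      Finset.mem_image.2 ⟨(x, t), Finset.mem_product.2 ⟨Finset.mem_univ _, ht⟩, rfl⟩⟩
  have hMS : ∀ q ∈ Mall, q ∈ S := fun q hq => Finset.mem_union_right _ hq
  have hrankX : ∀ x, rank (MvPolynomial.X x) = 0 := by
    intro x
    simp only [rank]
    split_ifs with h1 h2
    · rfl
    · rfl
    · exact absurd (Finset.mem_image.2 ⟨x, Finset.mem_univ _, rfl⟩) h2
    · exact absurd (Finset.mem_image.2 ⟨x, Finset.mem_univ _, rfl⟩) h2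
  -- rank of an `M`-value is `< 2 e` where `e` is its degree
  have hrankM : ∀ m, m < d → ∀ t ∈ T (m + 1), ∀ x : Fin n × Fin n,
      rank (MvPolynomial.X x * t) < 2 * (d - m) := by
    intro m hm t ht x
    simp only [rank]
    split_ifs with h1 h2 h3
    · omega
    · omega
    · have h0 : MvPolynomial.X x * t ≠ 0 := fun h => h1 (by rw [h, totalDegree_zero])
      rw [hdegM m t ht x h0]; omega
    · exact absurd (hMmem m hm t ht x) h3
  -- the steps
  have hstep : ∀ q ∈ S, ∃ st : StepData ℂ (Fin n × Fin n), st.Valid S rank q := by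
    intro q hq
    by_cases h0 : q.totalDegree = 0
    · refine ⟨StepData.const (coeff 0 q), ⟨(totalDegree_eq_zero_iff_eq_C.mp h0).symm, fun u hu => ?_⟩⟩
      simp [StepData.args] at hu
    by_cases hV : q ∈ Vars
    · obtain ⟨x, -, rfl⟩ := Finset.mem_image.mp hV
      exact ⟨StepData.var x, ⟨rfl, fun u hu => by simp [StepData.args] at hu⟩⟩
    have hq0 : q ≠ 0 := fun h => h0 (by rw [h, totalDegree_zero])
    by_cases hM : q ∈ Mall
    · -- product step
      have hrq : rank q = 2 * q.totalDegree - 1 := by simp only [rank, if_neg h0, if_neg hV, if_pos hM]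
      obtain ⟨m, hm, hq'⟩ := Finset.mem_biUnion.mp hM
      rw [Finset.mem_range] at hm
      obtain ⟨p, hp, hpq⟩ := Finset.mem_image.mp hq'
      have ht : p.2 ∈ T (m + 1) := (Finset.mem_product.mp hp).2
      have hq0' : MvPolynomial.X p.1 * p.2 ≠ 0 := by rw [hpq]; exact hq0
      have ht0 : p.2 ≠ 0 := fun h => hq0' (by rw [h, mul_zero])
      have hdq : q.totalDegree = d - (m + 1) + 1 := by rw [← hpq]; exact hdegM m _ ht _ hq0'
      refine ⟨StepData.prod (MvPolynomial.X p.1) p.2, ⟨hpq, fun u hu => ?_⟩⟩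
      simp only [StepData.args, Multiset.insert_eq_cons, Multiset.mem_cons, Multiset.mem_singleton] at hu
      rcases hu with rfl | rfl
      · exact ⟨hXS _, by rw [hrankX, hrq, hdq]; omega⟩
      · refine ⟨hTS (m + 1) (by omega) _ ht, ?_⟩
        have := hrank_le p.2
        rw [hdegT _ _ ht ht0] at this
        rw [hrq, hdq]; omega
    · -- Euler step: `q ∈ T m`
      have hrq : rank q = 2 * q.totalDegree := by simp only [rank, if_neg h0, if_neg hV, if_neg hM]
      have hqT : q ∈ Tall := by
        rcases Finset.mem_union.mp hq with hq | hq
        · rcases Finset.mem_union.mp hq with hq | hq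
          · exact absurd hq hV
          · exact hq
        · exact absurd hq hM
      obtain ⟨m, hm, hqm⟩ := Finset.mem_biUnion.mp hqT
      rw [Finset.mem_range] at hm
      have hqh : q.IsHomogeneous (d - m) := hhom m q hqm
      have hdq : q.totalDegree = d - m := hqh.totalDegree hq0
      have hmd : m < d := by omega
      -- coefficients of the partial derivatives in `T (m+1)`
      have hcoef : ∀ x : Fin n × Fin n, ∃ c : MvPolynomial (Fin n × Fin n) ℂ → ℂ,
          ∑ t ∈ T (m + 1), c t • t = pderiv x q := fun x => by
        obtain ⟨c, -, hc⟩ := Submodule.mem_span_finset.mp (hder m hmd q hqm x)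
        exact ⟨c, hc⟩
      choose c hc using hcoef
      set e : ℕ := d - m with he
      have he0 : (e : ℂ) ≠ 0 := by exact_mod_cast (show e ≠ 0 by omega)
      let D : Multiset (ℂ × MvPolynomial (Fin n × Fin n) ℂ) :=
        (((Finset.univ : Finset (Fin n × Fin n)) ×ˢ T (m + 1)).val).map
          fun p => ((e : ℂ)⁻¹ * c p.1 p.2, MvPolynomial.X p.1 * p.2)
      refine ⟨StepData.sum D, ⟨?_, fun u hu => ?_⟩⟩
      · -- the value
        show (D.map fun cu => C cu.1 * cu.2).sum = q
        rw [Multiset.map_map]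
        have hsum : (Multiset.map ((fun cu : ℂ × MvPolynomial (Fin n × Fin n) ℂ => C cu.1 * cu.2) ∘
            fun p : (Fin n × Fin n) × MvPolynomial (Fin n × Fin n) ℂ =>
              ((e : ℂ)⁻¹ * c p.1 p.2, MvPolynomial.X p.1 * p.2))
            (((Finset.univ : Finset (Fin n × Fin n)) ×ˢ T (m + 1)).val)).sum =
            ∑ p ∈ (Finset.univ : Finset (Fin n × Fin n)) ×ˢ T (m + 1),
              C ((e : ℂ)⁻¹ * c p.1 p.2) * (MvPolynomial.X p.1 * p.2) :=
          (Finset.sum_eq_multiset_sum _ _).symm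
        rw [hsum, Finset.sum_product]
        have h1 : ∀ x : Fin n × Fin n, ∑ t ∈ T (m + 1), C ((e : ℂ)⁻¹ * c x t) * (MvPolynomial.X x * t) =
            C (e : ℂ)⁻¹ * (MvPolynomial.X x * pderiv x q) := by
          intro x
          rw [← hc x, Finset.mul_sum, Finset.mul_sum]
          refine Finset.sum_congr rfl fun t _ => ?_
          rw [smul_eq_C_mul, map_mul]
          ring
        rw [Finset.sum_congr rfl fun x _ => h1 x, ← Finset.mul_sum, hqh.sum_X_mul_pderiv, nsmul_eq_mul,
          ← mul_assoc, ← map_natCast (C : ℂ →+* MvPolynomial (Fin n × Fin n) ℂ), ← map_mul,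
          inv_mul_cancel₀ he0, map_one, one_mul]
      · -- the operands
        simp only [StepData.args, D, Multiset.map_map, Function.comp_def, Multiset.mem_map, Finset.mem_val,
          Finset.mem_product, Finset.mem_univ, true_and] at hu
        obtain ⟨p, hp, rfl⟩ := hu
        refine ⟨hMS _ (hMmem m hmd _ hp _), ?_⟩
        rw [hrq, hdq]
        exact hrankM m hmd _ hp _
  -- the derivation and the orbit bounds
  let 𝒟 : ValueDerivation ℂ (Fin n × Fin n) := ⟨S, rank, hstep⟩
  have hfS : f ∈ 𝒟.S := hTS 0 (Nat.zero_le d) f hf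
  have horb : ∀ q ∈ 𝒟.S, (Set.range fun σ : Perm (Fin n) => ren σ q).ncard ≤
      2 ^ ((Nat.log 2 n + (k + 3)) ^ (k + 3)) := by
    intro q hq
    refine le_trans ?_ (pow_le_qp n k)
    rcases Finset.mem_union.mp hq with hq | hq
    · rcases Finset.mem_union.mp hq with hq | hq
      · obtain ⟨x, -, rfl⟩ := Finset.mem_image.mp hq
        exact ncard_orbit_X_le k x
      · obtain ⟨m, -, hqm⟩ := Finset.mem_biUnion.mp hq
        obtain ⟨Y, hYk, hY⟩ := hsupp m q hqm
        exact ncard_orbit_le_of_supported hYk hY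
    · obtain ⟨m, -, hq'⟩ := Finset.mem_biUnion.mp hq
      obtain ⟨p, hp, rfl⟩ := Finset.mem_image.mp hq'
      obtain ⟨Y, hYk, hY⟩ := hsupp (m + 1) p.2 (Finset.mem_product.mp hp).2
      exact ncard_orbit_X_mul_le hYk hY p.1
  obtain ⟨G, inst, C, hC, hev, hOrb⟩ := ValueOrbit.qpOrbit_of_valueDerivation (c := k + 3) 𝒟 hfS hfix horb
  exact ⟨G, inst, C, hC, hev, hOrb⟩

end DerivativeTower

end Summit.ValiantsHypothesis.ValiantsHypothesis.Theorems

end
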